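import Literature.Probability.Percolation.CutPointArms
import Literature.Probability.Percolation.ArmSeparationGlue
import Literature.Combinatorics.SimpleGraph.MengerTwo
import HarnessLib

/-!
# Pivotal sites of the four-arm event: the Menger cut and the local four arms (proofs only)

Topic `Literature/Probability/Percolation`; family `crit-perc`, statement **crit-perc.S16**
(`Literature.Probability.Percolation.triTheta_exponent`). Proofs only (no new definition, no new
named fact). The pattern-dependent part of W. Werner's estimate of the pivotal sites of the
four-arm event (PCMI 2009, Lecture 6, §5, "Using differential inequalities for the four arm
event": "if `x` is pivotal for `Π̂_n`, then one has a four-arm event in each of the three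
'annuli'", the third annulus being the one around `x`), for the tree's ORDER-FREE four-arm event
`armEvent ![T,F,T,F] r₀ N = O₂ ∩ C₂` (two disjoint open arms and two disjoint closed arms across
`Λ_N ∖ Λ_{r₀}`; `armEvent_four_eq_inter`), following P. Nolin, *Near-critical percolation in two
dimensions*, Electron. J. Probab. 13 (2008), §6.2, proof of Thm. 27, **Case 3** [arXiv 0711.4948:
Thm. 26]: the two open arms form a "pack", and "being pivotal does not always give rise to four
arms in `R(v)`"; "This new definition allows to use Menger's theorem": if opening `v` creates the
event (`ω ∪ {v} ∈ O₂ ∩ C₂`, `ω ∖ {v} ∉ O₂ ∩ C₂`), then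

* (`exists_cut_of_pivotal_plus`) `ω ∪ {v}` has two disjoint open arms `o₁ ∋ v`, `o₂`, and there is
  ONE open site `P ∈ o₂` (the *defect*) lying on every open arm of `ω ∖ {v}` — Menger's theorem for
  two paths (`Literature.Combinatorics.SimpleGraph.exists_mem_support_forall`) applied to the open
  sites of `ω ∖ {v}` in the annulus, where `o₂` is an arm but no two disjoint arms exist;
* (`relabel_shift_diff_mem_armEvent_of_cut`) consequently, in the configuration `ω ∖ {P}` the two
  halves of `o₁` at `v` cannot be joined by an open path of the box `v + [-d, d]²` avoiding `v`
  (that would be an open arm of `ω ∖ {v}` avoiding `P`), so the cut-point lemma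
  (`armEvent_of_cutPoint`, `CutPointArms.lean`: the padded Hex-lemma duality) gives four
  alternating arms from `∂Λ₁(v)` to `∂Λ_d(v)` in `ω ∖ {P}`, for EVERY admissible box size `d`
  (`r₀ + 2d ≤ |v|_𝕋`, `|v|_𝕋 + 2d ≤ N`);
* (`relabel_shift_mem_armEvent_four_of_cut`) for `d < |P - v|_𝕋` these are four alternating arms
  of `ω` itself: Nolin's "there are `4` alternating arms `v ⇝ ∂S_{2^{l'}}(v)`" up to the scale of
  the defect.

The six arms beyond the defect ("and also `6` arms `∂S_{2^{l'+1}}(v) ⇝ ∂S_{2^l}(v)`", with NO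
further defect here since the pack has two arms) and the probability estimates are the sequel.

## References

* P. Nolin, Near-critical percolation in two dimensions, *Electron. J. Probab.* 13 (2008), §6.2,
  proof of Thm. 27, Case 3 and Fig. 9 [arXiv 0711.4948: Thm. 26] [Nolin2008].
* W. Werner, *Lectures on two-dimensional critical percolation*, IAS/Park City Math. Ser. 16
  (2009), Lecture 6, §5 [WernerPCMI2009].
* R. Diestel, *Graph Theory*, 5th ed. (2017), Thm. 3.3.1 (Menger) [Diestel2017].
* H. Kesten, Scaling relations for 2D-percolation, *Comm. Math. Phys.* 109 (1987), Lemma 8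
  [KestenScalingCMP1987].

Tree: `armEvent`, `IsColouredPath` (`ArmEvents.lean`), `armEvent_eq_inter_of_equiv`,
`isLowerSet_armEvent` (`ArmEventsStructure.lean`), `mem_triAnnulus_of_arm`, `armEvent_determined`
(`ArmEventsProofs.lean`), `mem_armEvent_of_pathIn`, `PathIn.split_at`, `triNorm_sub_eq_one_of_adj`
(`ParaPivotalArms.lean`), `armEvent_of_cutPoint`, `triSqBox`, `triNorm_add_le`,
`triNorm_le_abs_add_abs` (`CutPointArms.lean`), `PathIn` API (`SitePaths.lean`, `OneArmLSW.lean`,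
`TriRSWChaining.lean`), `triShiftIso`, `SiteConfig.relabel`,
`Literature.Combinatorics.SimpleGraph.exists_mem_support_forall` (`MengerTwo.lean`).
-/

noncomputable section

open MeasureTheory Set

namespace Literature.Probability.Percolation

open LatticeModels

/-! ### The four-arm event as `O₂ ∩ C₂` -/

/-- **`armEvent ![T,F,T,F] = O₂ ∩ C₂`**: the tree's (order-free) four-arm event is the
intersection of the increasing event "two disjoint open arms" and the decreasing event "two
disjoint closed arms" (Nolin 2008, §6.2, Case 2–3: `Ã = Ã⁺ ∩ Ã⁻`; `armEvent_eq_inter_of_equiv`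
with the splitting `{0, 2} ⊔ {1, 3}` of the indices). [cite: Nolin2008, §6.2, proof of Thm. 27 (arXiv 0711.4948: Thm. 26)] -/
theorem armEvent_four_eq_inter (r R : ℕ) :
    armEvent ![true, false, true, false] r R =
      armEvent (fun _ : Fin 2 => true) r R ∩ armEvent (fun _ : Fin 2 => false) r R :=
  armEvent_eq_inter_of_equiv ![true, false, true, false] r R
    ((finSumFinEquiv (m := 2) (n := 2)).trans (Equiv.swap (1 : Fin 4) 2))
    (by decide) (by decide)

/-! ### The Menger cut -/

/-- **The defect of a pivotal site of the two-open-arm event** (Nolin 2008, §6.2, proof of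
Thm. 27, Case 3: "This new definition allows to use Menger's theorem … there exists a path `c`
… white, except in (at most) `l_q - 1` sites", here `l_q = 2`). If `r₀ < |v|_𝕋 < N`, opening `v`
produces the four-arm event `armEvent ![T,F,T,F] r₀ N` and closing `v` destroys it, then
`ω ∪ {v}` has two vertex-disjoint open self-avoiding arms `o₁`, `o₂` across `{r₀ ≤ |·|_𝕋 ≤ N}`
with `v ∈ o₁` (so `o₂` is open in `ω`), and there is a site `P ∈ o₂` through which passes EVERY
walk of the annulus from `∂Λ_{r₀}` to `∂Λ_N` whose sites are open sites of `ω` other than `v`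
(Menger's theorem for two paths, `exists_mem_support_forall`: `o₂` is such a walk, and two
disjoint ones would put `ω ∖ {v}` in `O₂`, hence — the closed arms surviving — in the four-arm
event). [cite: Nolin2008, §6.2, proof of Thm. 27, Case 3 (arXiv 0711.4948: Thm. 26)] [cite: Diestel2017, Thm. 3.3.1] -/
theorem exists_cut_of_pivotal_plus {r₀ N : ℕ} {v : Site 2} {ω : SiteConfig (Site 2)}
    (hr : (r₀ : ℤ) < triNorm v) (hN : triNorm v < N)
    (hplus : insert v ω ∈ armEvent ![true, false, true, false] r₀ N)
    (hminus : ω \ {v} ∉ armEvent ![true, false, true, false] r₀ N) :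
    ∃ (x₁ y₁ x₂ y₂ P : Site 2) (o₁ : triGraph.Walk x₁ y₁) (o₂ : triGraph.Walk x₂ y₂),
      triNorm x₁ = r₀ ∧ triNorm y₁ = N ∧ triNorm x₂ = r₀ ∧ triNorm y₂ = N ∧
      o₁.IsPath ∧ o₂.IsPath ∧
      (∀ z ∈ o₁.support, (r₀ : ℤ) ≤ triNorm z ∧ triNorm z ≤ N) ∧
      (∀ z ∈ o₂.support, (r₀ : ℤ) ≤ triNorm z ∧ triNorm z ≤ N) ∧
      v ∈ o₁.support ∧ (∀ z ∈ o₁.support, z ≠ v → z ∈ ω) ∧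
      (∀ z ∈ o₂.support, z ∈ ω ∧ z ≠ v) ∧ (∀ z ∈ o₁.support, z ∉ o₂.support) ∧
      P ∈ o₂.support ∧
      ∀ (s t : Site 2) (q : triGraph.Walk s t), triNorm s = r₀ → triNorm t = N →
        (∀ z ∈ q.support, ((r₀ : ℤ) ≤ triNorm z ∧ triNorm z ≤ N) ∧ z ∈ ω ∧ z ≠ v) →
        P ∈ q.support := by
  classical
  have hrN : r₀ ≤ N := by
    have : (r₀ : ℤ) ≤ N := by omega
    exact_mod_cast this
  rw [armEvent_four_eq_inter] at hplus hminus
  obtain ⟨hO, hC⟩ := hplus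
  -- the closed arms survive the closing of `v`
  have hC' : ω \ {v} ∈ armEvent (fun _ : Fin 2 => false) r₀ N :=
    isLowerSet_armEvent (fun _ => rfl) r₀ N
      (show ω \ {v} ≤ insert v ω from fun z hz => mem_insert_of_mem _ hz.1) hC
  have hO' : ω \ {v} ∉ armEvent (fun _ : Fin 2 => true) r₀ N := fun h => hminus ⟨h, hC'⟩
  obtain ⟨x, y, w, hw, hdisj⟩ := hO
  -- the admissible set: open sites of `ω ∖ {v}` in the closed annulus
  obtain ⟨A, hA⟩ : ∃ A : Set (Site 2), ∀ z, z ∈ A ↔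
      ((r₀ : ℤ) ≤ triNorm z ∧ triNorm z ≤ N) ∧ z ∈ ω ∧ z ≠ v := ⟨{z | _}, fun _ => Iff.rfl⟩
  have hann : ∀ j, ∀ z ∈ (w j).support, (r₀ : ℤ) ≤ triNorm z ∧ triNorm z ≤ N := fun j z hz =>
    mem_triAnnulus.1 (mem_triAnnulus_of_arm hrN ((hw j).2.2.2.1 z hz))
  have hcol : ∀ j, ∀ z ∈ (w j).support, z ∈ insert v ω := fun j z hz => by
    simpa using (hw j).2.2.2.2 z hz
  -- `v` lies on one of the two open arms
  have hv : ∃ i, v ∈ (w i).support := by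
    by_contra hcon
    push Not at hcon
    refine hO' ⟨x, y, w, fun j => ?_, hdisj⟩
    obtain ⟨hx, hy, hp, hs, -⟩ := hw j
    refine ⟨hx, hy, hp, hs, fun z hz => ?_⟩
    have hzv : z ≠ v := fun h => hcon j (h ▸ hz)
    have hzω : z ∈ ω := (mem_insert_iff.1 (hcol j z hz)).resolve_left hzv
    simp [hzω, hzv]
  obtain ⟨i, hvi⟩ := hv
  obtain ⟨j, hji⟩ : ∃ j : Fin 2, j ≠ i := by
    fin_cases i
    · exact ⟨1, by decide⟩
    · exact ⟨0, by decide⟩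
  have hdisj12 : ∀ z ∈ (w i).support, z ∉ (w j).support := fun z hz hz' =>
    Finset.disjoint_left.1 (hdisj hji.symm) (List.mem_toFinset.2 hz) (List.mem_toFinset.2 hz')
  have hvj : v ∉ (w j).support := hdisj12 v hvi
  have ho₂A : ∀ z ∈ (w j).support, z ∈ A := fun z hz =>
    (hA z).2 ⟨hann j z hz, (mem_insert_iff.1 (hcol j z hz)).resolve_left (fun h => hvj (h ▸ hz)),
      fun h => hvj (h ▸ hz)⟩
  -- Menger's theorem for two paths
  have hone : ∃ (s t : Site 2) (q : triGraph.Walk s t), s ∈ (↑(triSphere r₀) : Set (Site 2)) ∧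
      t ∈ (↑(triSphere N) : Set (Site 2)) ∧ ∀ z ∈ q.support, z ∈ A :=
    ⟨x j, y j, w j, (hw j).1, (hw j).2.1, ho₂A⟩
  have htwo : ¬ ∃ (s₁ t₁ s₂ t₂ : Site 2) (p₁ : triGraph.Walk s₁ t₁) (p₂ : triGraph.Walk s₂ t₂),
      s₁ ∈ (↑(triSphere r₀) : Set (Site 2)) ∧ t₁ ∈ (↑(triSphere N) : Set (Site 2)) ∧
      s₂ ∈ (↑(triSphere r₀) : Set (Site 2)) ∧ t₂ ∈ (↑(triSphere N) : Set (Site 2)) ∧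
      p₁.IsPath ∧ p₂.IsPath ∧ (∀ z ∈ p₁.support, z ∈ A) ∧ (∀ z ∈ p₂.support, z ∈ A) ∧
      ∀ z ∈ p₁.support, z ∉ p₂.support := by
    rintro ⟨s₁, t₁, s₂, t₂, p₁, p₂, hs₁, ht₁, hs₂, ht₂, -, -, hp₁A, hp₂A, hdj⟩
    obtain ⟨T, hT⟩ : ∃ T : Fin 2 → Set (Site 2),
        T 0 = {z | z ∈ p₁.support} ∧ T 1 = {z | z ∈ p₂.support} :=
      ⟨![{z | z ∈ p₁.support}, {z | z ∈ p₂.support}], rfl, rfl⟩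
    refine hO' (mem_armEvent_of_pathIn (fun _ : Fin 2 => true) T ?_ ?_ ?_ ?_)
    · intro a b hab
      fin_cases a <;> fin_cases b
      · exact absurd rfl hab
      · change Disjoint (T 0) (T 1)
        rw [hT.1, hT.2]; exact Set.disjoint_left.2 fun z hz hz' => hdj z hz hz'
      · change Disjoint (T 1) (T 0)
        rw [hT.1, hT.2]; exact Set.disjoint_left.2 fun z hz hz' => hdj z hz' hz
      · exact absurd rfl hab
    · intro a z hz
      fin_cases a
      · change z ∈ T 0 at hz
        rw [hT.1] at hz
        obtain ⟨-, h2, h3⟩ := (hA z).1 (hp₁A z hz)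
        simp [h2, h3]
      · change z ∈ T 1 at hz
        rw [hT.2] at hz
        obtain ⟨-, h2, h3⟩ := (hA z).1 (hp₂A z hz)
        simp [h2, h3]
    · intro a z hz
      fin_cases a
      · change z ∈ T 0 at hz
        rw [hT.1] at hz; exact ((hA z).1 (hp₁A z hz)).1
      · change z ∈ T 1 at hz
        rw [hT.2] at hz; exact ((hA z).1 (hp₂A z hz)).1
    · intro a
      fin_cases a
      · refine ⟨s₁, hs₁, t₁, ht₁, ?_⟩
        change PathIn triGraph (T 0) s₁ t₁
        rw [hT.1]; exact PathIn.of_walk p₁ fun z hz => hz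
      · refine ⟨s₂, hs₂, t₂, ht₂, ?_⟩
        change PathIn triGraph (T 1) s₂ t₂
        rw [hT.2]; exact PathIn.of_walk p₂ fun z hz => hz
  obtain ⟨P, hPA, hPall⟩ :=
    Literature.Combinatorics.SimpleGraph.exists_mem_support_forall hone htwo
  have hPo₂ : P ∈ (w j).support := hPall _ _ (w j) (hw j).1 (hw j).2.1 ho₂A
  refine ⟨x i, y i, x j, y j, P, w i, w j, mem_triSphere_iff.1 (hw i).1,
    mem_triSphere_iff.1 (hw i).2.1, mem_triSphere_iff.1 (hw j).1, mem_triSphere_iff.1 (hw j).2.1,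
    (hw i).2.2.1, (hw j).2.2.1, hann i, hann j, hvi,
    fun z hz hzv => (mem_insert_iff.1 (hcol i z hz)).resolve_left hzv,
    fun z hz => ⟨((hA z).1 (ho₂A z hz)).2.1, ((hA z).1 (ho₂A z hz)).2.2⟩, hdisj12, hPo₂,
    fun s t q hs ht hq => hPall s t q (mem_triSphere_iff.2 hs) (mem_triSphere_iff.2 ht)
      fun z hz => (hA z).2 (hq z hz)⟩

/-! ### The cut-point lemma at a pivotal site of the two-open-arm event -/

section Cut

variable {r₀ N d : ℕ} {v P x₁ y₁ : Site 2} {ω : SiteConfig (Site 2)}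

/-- **Four alternating arms around a pivotal site of `O₂`, in `ω ∖ {P}`** (Nolin 2008, §6.2,
proof of Thm. 27, Case 3, Fig. 9; Werner 2009, Lecture 6, §5, the annulus around `x`). Let `o₁`
be an open (off `v`) self-avoiding walk of the annulus `{r₀ ≤ |·|_𝕋 ≤ N}` from `∂Λ_{r₀}` to `∂Λ_N`
through `v`, not through `P`, and suppose every walk of the annulus from `∂Λ_{r₀}` to `∂Λ_N`
through open sites of `ω` other than `v` passes through `P` (`exists_cut_of_pivotal_plus`). Then
for every box size `d ≥ 1` with `r₀ + 2d ≤ |v|_𝕋` and `|v|_𝕋 + 2d ≤ N`, the translate by `-v` of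
`ω ∖ {P}` has four disjoint arms open/closed/open/closed from `∂Λ₁` to `∂Λ_d`: the two halves of
`o₁` at `v`, stopped on the boundary of `v + [-d, d]²`, cannot be joined inside the box by an open
path of `ω ∖ {P}` avoiding `v` (with the two tails of `o₁` this would be an admissible walk
avoiding `P`), and the cut-point lemma `armEvent_of_cutPoint` applies. [cite: Nolin2008, §6.2, proof of Thm. 27, Case 3 (arXiv 0711.4948: Thm. 26, Fig. 9)] [cite: WernerPCMI2009, Lecture 6, §5 ("the three annuli")] -/
theorem relabel_shift_diff_mem_armEvent_of_cut (o₁ : triGraph.Walk x₁ y₁) (hd : 1 ≤ d)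
    (hvr : (r₀ : ℤ) + 2 * d ≤ triNorm v) (hvN : triNorm v + 2 * d ≤ N)
    (hx₁ : triNorm x₁ = r₀) (hy₁ : triNorm y₁ = N)
    (ho₁ann : ∀ z ∈ o₁.support, (r₀ : ℤ) ≤ triNorm z ∧ triNorm z ≤ N)
    (ho₁ω : ∀ z ∈ o₁.support, z ≠ v → z ∈ ω) (hPo₁ : P ∉ o₁.support)
    (hcut : ∀ (s t : Site 2) (q : triGraph.Walk s t), triNorm s = r₀ → triNorm t = N →
      (∀ z ∈ q.support, ((r₀ : ℤ) ≤ triNorm z ∧ triNorm z ≤ N) ∧ z ∈ ω ∧ z ≠ v) →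
      P ∈ q.support) :
    SiteConfig.relabel (triShiftIso (-v)).toEquiv (ω \ {P}) ∈
      armEvent ![true, false, true, false] 1 d := by
  classical
  have hd0 : (0 : ℤ) ≤ d := by positivity
  -- admissible sites off `v` (role of `A'`), and the sites of the open walk (role of `B`)
  obtain ⟨A', hA'⟩ : ∃ A' : Set (Site 2), ∀ z, z ∈ A' ↔
      ((r₀ : ℤ) ≤ triNorm z ∧ triNorm z ≤ N) ∧ z ∈ ω ∧ z ≠ v ∧ z ≠ P := ⟨{z | _}, fun _ => Iff.rfl⟩
  obtain ⟨B, hB⟩ : ∃ B : Set (Site 2), ∀ z, z ∈ B ↔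
      ((r₀ : ℤ) ≤ triNorm z ∧ triNorm z ≤ N) ∧ (z = v ∨ (z ∈ ω ∧ z ≠ P)) :=
    ⟨{z | _}, fun _ => Iff.rfl⟩
  have hγ : PathIn triGraph B x₁ y₁ := PathIn.of_walk o₁ fun z hz => (hB z).2 ⟨ho₁ann z hz, by
    by_cases hzv : z = v
    · exact Or.inl hzv
    · exact Or.inr ⟨ho₁ω z hz hzv, fun h => hPo₁ (h ▸ hz)⟩⟩
  set A : Set (Site 2) := B \ {v} with hAdef
  have hAmem : ∀ z, z ∈ A ↔ ((r₀ : ℤ) ≤ triNorm z ∧ triNorm z ≤ N) ∧ z ∈ ω ∧ z ≠ P ∧ z ≠ v := by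
    intro z
    rw [hAdef, mem_sdiff, mem_singleton_iff, hB]
    constructor
    · rintro ⟨⟨h1, h2⟩, hzv⟩
      exact ⟨h1, (h2.resolve_left hzv).1, (h2.resolve_left hzv).2, hzv⟩
    · rintro ⟨h1, h2, h3, h4⟩
      exact ⟨⟨h1, Or.inr ⟨h2, h3⟩⟩, h4⟩
  have hAsub : A ⊆ A' := fun z hz => by
    obtain ⟨h1, h2, h3, h4⟩ := (hAmem z).1 hz
    exact (hA' z).2 ⟨h1, h2, h4, h3⟩
  have hx₁v : x₁ ≠ v := by intro h; rw [h] at hx₁; omega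
  have hy₁v : y₁ ≠ v := by intro h; rw [h] at hy₁; omega
  -- no admissible path from `x₁` to `y₁` (it would avoid the cut `P`)
  have hnot : ¬ PathIn triGraph A' x₁ y₁ := by
    intro hp
    obtain ⟨W, hW⟩ := hp.exists_walk
    have hPW := hcut x₁ y₁ W hx₁ hy₁ fun z hz => by
      obtain ⟨h1, h2, h3, -⟩ := (hA' z).1 (hW z hz); exact ⟨h1, h2, h3⟩
    exact ((hA' P).1 (hW P hPW)).2.2.2 rfl
  -- the open walk passes through `v`
  rcases hγ.split_at v with havoid | ⟨hP', hS'⟩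
  · exact (hnot (havoid.mono hAsub)).elim
  obtain ⟨a₁', ha₁', hpre⟩ := hP'.resolve_left hx₁v
  obtain ⟨b₁', hb₁', hsuf⟩ := hS'.resolve_left hy₁v
  -- translate by `-v`
  set φ := triShiftIso (-v) with hφ
  have hφapp : ∀ w, φ w = w - v := fun w => by simp [hφ, sub_eq_add_neg]
  have himage : ∀ (T : Set (Site 2)) (w : Site 2), w ∈ φ '' T ↔ w + v ∈ T := by
    intro T w
    constructor
    · rintro ⟨w', hw', rfl⟩; rw [hφapp]; simpa using hw'
    · intro hw; exact ⟨w + v, hw, by rw [hφapp]; simp⟩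
  set ξ : SiteConfig (Site 2) := SiteConfig.relabel φ.toEquiv (ω \ {P}) with hξ
  have hmemξ : ∀ w, w ∈ ξ ↔ w + v ∈ ω \ {P} := by
    intro w
    rw [hξ, SiteConfig.mem_relabel_iff]
    have : φ.toEquiv.symm w = w + v := by
      apply φ.toEquiv.injective
      rw [Equiv.apply_symm_apply]
      show w = φ (w + v)
      rw [hφapp]; simp
    rw [this]
  -- the translated half-paths, from neighbours of `0`
  have hα₀ : PathIn triGraph (φ '' A) (φ a₁') (φ x₁) := pathIn_map_iso φ hpre.symm
  have hβ₀ : PathIn triGraph (φ '' A) (φ b₁') (φ y₁) := pathIn_map_iso φ hsuf.symm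
  have hadj : ∀ {u : Site 2}, triGraph.Adj u v → triGraph.Adj (φ u) 0 := by
    intro u hu
    have := φ.map_adj_iff.2 hu
    rwa [show φ v = 0 by rw [hφapp, sub_self]] at this
  -- sites of `φ '' A` are open sites of `ξ` other than `0`
  have hAξ : ∀ w ∈ φ '' A, w ∈ ξ ∧ w ≠ 0 := by
    intro w hw
    rw [himage] at hw
    obtain ⟨-, hw2, hw3, hw4⟩ := (hAmem _).1 hw
    refine ⟨(hmemξ w).2 ⟨hw2, hw3⟩, fun h => hw4 ?_⟩
    rw [h, zero_add]
  -- the interior of the box; the far endpoints lie outside it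
  set R : Set (Site 2) := {z | |z 0| < d ∧ |z 1| < d} with hR
  have hRmem : ∀ {z : Site 2}, z ∈ R ↔ |z 0| < d ∧ |z 1| < d := fun {z} => Iff.rfl
  have hfar : ∀ {w : Site 2}, 2 * (d : ℤ) ≤ triNorm w → w ∉ R := by
    intro w hw hwR
    obtain ⟨h0, h1⟩ := hwR
    have := triNorm_le_abs_add_abs w
    omega
  have hφx₁far : φ x₁ ∉ R := by
    apply hfar
    rw [hφapp]
    have h1 := triNorm_add_le (v - x₁) x₁
    rw [sub_add_cancel] at h1
    have h2 : triNorm (x₁ - v) = triNorm (v - x₁) := by rw [← triNorm_neg, neg_sub]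
    omega
  have hφy₁far : φ y₁ ∉ R := by
    apply hfar
    rw [hφapp]
    have := triNorm_add_le (y₁ - v) v
    rw [sub_add_cancel] at this
    omega
  -- stopping a half-path on the boundary of the box, with a tight support
  have stop : ∀ {u₁ e : Site 2}, triGraph.Adj u₁ 0 → e ∉ R → PathIn triGraph (φ '' A) u₁ e →
      ∃ (S : Set (Site 2)) (c : Site 2), S ⊆ triSqBox d ∩ φ '' A ∧ PathIn triGraph S u₁ c ∧
        (|c 0| = d ∨ |c 1| = d) ∧ ∀ z ∈ S, PathIn triGraph (φ '' A) u₁ z := by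
    intro u₁ e hu₁ he hp
    have hu₁1 : triNorm u₁ = 1 := by
      have := triNorm_sub_eq_one_of_adj hu₁; rwa [sub_zero] at this
    obtain ⟨hu0, hu1, -⟩ := abs_le_triNorm u₁
    by_cases huR : u₁ ∈ R
    · obtain ⟨p, q, hpR, hqR, hqA, hpq, hpath⟩ := hp.exit huR he
      have hpath' : PathIn triGraph (insert q (R ∩ φ '' A)) u₁ q :=
        (hpath.mono fun z hz => mem_insert_of_mem _ hz).tail hpq (mem_insert q _)
      obtain ⟨S, hS, hSp, hall⟩ := hpath'.exists_support
      have hq : q ∈ triSqBox d ∧ (|q 0| = d ∨ |q 1| = d) := by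
        rw [hRmem, abs_lt, abs_lt] at hpR
        rw [hRmem, not_and_or, not_lt, not_lt, le_abs, le_abs] at hqR
        rw [triGraph_adj_iff_coord] at hpq
        rw [mem_triSqBox, abs_le, abs_le, abs_eq hd0, abs_eq hd0]
        omega
      have hSsub : S ⊆ triSqBox d ∩ φ '' A := by
        intro z hz
        rcases hS hz with h | ⟨hzR, hzA⟩
        · rw [h]; exact ⟨hq.1, hqA⟩
        · rw [hRmem, abs_lt, abs_lt] at hzR
          exact ⟨by rw [mem_triSqBox, abs_le, abs_le]; omega, hzA⟩
      exact ⟨S, q, hSsub, hSp, hq.2, fun z hz => (hall z hz).mono fun w hw => (hSsub hw).2⟩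
    · refine ⟨{u₁}, u₁, ?_, PathIn.refl (mem_singleton u₁), ?_, ?_⟩
      · intro z hz
        rw [mem_singleton_iff] at hz
        rw [hz]
        exact ⟨by rw [mem_triSqBox]; constructor <;> omega, hp.left_mem⟩
      · rw [hRmem, not_and_or, not_lt, not_lt] at huR
        rcases huR with h | h
        · left; omega
        · right; omega
      · intro z hz
        rw [mem_singleton_iff] at hz
        rw [hz]
        exact PathIn.refl hp.left_mem
  obtain ⟨Sα, a, hSα, hα, had, hallα⟩ := stop (hadj ha₁') hφx₁far hα₀
  obtain ⟨Sβ, b, hSβ, hβ, hbd, hallβ⟩ := stop (hadj hb₁') hφy₁far hβ₀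
  have hSα' : Sα ⊆ (triSqBox d \ {0}) ∩ ξ := fun z hz =>
    ⟨⟨(hSα hz).1, (hAξ z (hSα hz).2).2⟩, (hAξ z (hSα hz).2).1⟩
  have hSβ' : Sβ ⊆ (triSqBox d \ {0}) ∩ ξ := fun z hz =>
    ⟨⟨(hSβ hz).1, (hAξ z (hSβ hz).2).2⟩, (hAξ z (hSβ hz).2).1⟩
  refine armEvent_of_cutPoint hd hSα' hSβ' (hadj ha₁') (hadj hb₁') hα hβ had hbd ?_
  -- the cut-point hypothesis: an open junction inside the box would bypass `v` AND `P`
  intro z hz z' hz' hp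
  have hT₁ : φ '' A ⊆ φ '' A' := image_mono hAsub
  have hT₂ : (triSqBox d \ {0}) ∩ ξ ⊆ φ '' A' := by
    rintro w ⟨⟨hw1, hw2⟩, hw3⟩
    rw [himage]
    obtain ⟨hwω, hwP⟩ := (hmemξ w).1 hw3
    rw [mem_singleton_iff] at hwP
    refine (hA' _).2 ⟨?_, hwω, fun h => hw2 ?_, hwP⟩
    · have h1 := triNorm_add_le w v
      have h2 := triNorm_le_abs_add_abs w
      have h3 := triNorm_add_le (w + v) (-w)
      rw [add_neg_cancel_comm, triNorm_neg] at h3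
      rw [mem_triSqBox] at hw1
      constructor <;> omega
    · have : w + v = v := h
      simpa using this
  have hjoin : PathIn triGraph (φ '' A') (φ x₁) (φ y₁) :=
    (((hα₀.symm.trans (hallα z hz)).mono hT₁).trans (hp.mono hT₂)).trans
      (((hallβ z' hz').symm.trans hβ₀).mono hT₁)
  -- translate back by `+v`
  have hback := pathIn_map_iso (triShiftIso v) hjoin
  have e1 : ∀ w, triShiftIso v (φ w) = w := fun w => by rw [triShiftIso_apply, hφapp]; abel
  rw [e1, e1] at hback
  have hset : (triShiftIso v) '' (φ '' A') = A' := by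
    ext u
    constructor
    · rintro ⟨w, hw, rfl⟩
      rw [himage] at hw
      rw [triShiftIso_apply]; exact hw
    · intro hu
      refine ⟨u - v, (himage A' (u - v)).2 (by rwa [sub_add_cancel]), ?_⟩
      rw [triShiftIso_apply, sub_add_cancel]
  rw [hset] at hback
  exact hnot hback

/-- **Four alternating arms of `ω` around a pivotal site of `O₂`, up to the defect** (Nolin
2008, §6.2, proof of Thm. 27, Case 3: "if … the defect on `c_{i'}` closest to `v` is in
`S_{2^{l'+1}}(v) ∖ S_{2^{l'}}(v)`, then there are `4` alternating arms `v ⇝ ∂S_{2^{l'}}(v)`"):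
under the hypotheses of `relabel_shift_diff_mem_armEvent_of_cut`, if moreover `d < |P - v|_𝕋`,
then `ω - v ∈ armEvent ![T,F,T,F] 1 d` (the event is determined by `Λ_d ∌ P - v`, where `ω` and
`ω ∖ {P}` agree). [cite: Nolin2008, §6.2, proof of Thm. 27, Case 3 (arXiv 0711.4948: Thm. 26, Fig. 9)] [cite: WernerPCMI2009, Lecture 6, §5 ("the three annuli")] -/
theorem relabel_shift_mem_armEvent_four_of_cut (o₁ : triGraph.Walk x₁ y₁) (hd : 1 ≤ d)
    (hvr : (r₀ : ℤ) + 2 * d ≤ triNorm v) (hvN : triNorm v + 2 * d ≤ N)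
    (hx₁ : triNorm x₁ = r₀) (hy₁ : triNorm y₁ = N)
    (ho₁ann : ∀ z ∈ o₁.support, (r₀ : ℤ) ≤ triNorm z ∧ triNorm z ≤ N)
    (ho₁ω : ∀ z ∈ o₁.support, z ≠ v → z ∈ ω) (hPo₁ : P ∉ o₁.support)
    (hcut : ∀ (s t : Site 2) (q : triGraph.Walk s t), triNorm s = r₀ → triNorm t = N →
      (∀ z ∈ q.support, ((r₀ : ℤ) ≤ triNorm z ∧ triNorm z ≤ N) ∧ z ∈ ω ∧ z ≠ v) →
      P ∈ q.support)
    (hdP : (d : ℤ) < triNorm (P - v)) :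
    SiteConfig.relabel (triShiftIso (-v)).toEquiv ω ∈ armEvent ![true, false, true, false] 1 d := by
  have h := relabel_shift_diff_mem_armEvent_of_cut o₁ hd hvr hvN hx₁ hy₁ ho₁ann ho₁ω hPo₁ hcut
  set φ := triShiftIso (-v) with hφ
  have hφapp : ∀ w, φ w = w - v := fun w => by simp [hφ, sub_eq_add_neg]
  have hsymm : ∀ w, φ.toEquiv.symm w = w + v := by
    intro w
    apply φ.toEquiv.injective
    rw [Equiv.apply_symm_apply]
    show w = φ (w + v)
    rw [hφapp]; simp
  refine (armEvent_determined _ hd _ _ fun z hz => ?_).2 h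
  rw [mem_triAnnulus] at hz
  rw [SiteConfig.mem_relabel_iff, SiteConfig.mem_relabel_iff, hsymm]
  have hzP : z + v ≠ P := by
    intro hzP
    have : z = P - v := by rw [← hzP, add_sub_cancel_right]
    rw [← this] at hdP
    omega
  simp [hzP]


/-- **Six arms beyond the defect** (Nolin 2008, §6.2, proof of Thm. 27, Case 3: "and also `6`
arms `∂S_{2^{l'+1}}(v) ⇝^{6,σ'₆} ∂S_{2^l}(v)`", `σ'₆ = BBWBBW`; here with no further defect, the
pack consisting of two arms). In the situation of `exists_cut_of_pivotal_plus` (two disjoint open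
arms `o₁ ∋ v`, `o₂ ∋ P` of `ω ∪ {v}` across `{r₀ ≤ |·|_𝕋 ≤ N}` and the cut `P`), for radii
`1 ≤ r' ≤ R` with `|P - v|_𝕋 < r'`, `r₀ + 2R ≤ |v|_𝕋` and `|v|_𝕋 + 2R ≤ N`, the translate `ω - v`
has six pairwise disjoint arms across `Λ_R ∖ Λ_{r'}`, four open and two closed
(`armEvent ![T,T,T,T,F,F] r' R`): the two halves of `o₁` at `v` and the two halves of `o₂` at `P`
(both `v` and `P` lie inside `Λ_{r'}(v)`, the four endpoints outside `Λ_R(v)`), and the outer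
parts of the two closed arms of `ω ∖ {P}` given by `relabel_shift_diff_mem_armEvent_of_cut` at
scale `R` (closed in `ω` off `P - v ∉ Λ_R ∖ Λ_{r'}`). [cite: Nolin2008, §6.2, proof of Thm. 27, Case 3 (arXiv 0711.4948: Thm. 26, Fig. 9)] -/
theorem relabel_shift_mem_armEvent_six_of_cut {R r' : ℕ} {x₂ y₂ : Site 2}
    (o₁ : triGraph.Walk x₁ y₁) (o₂ : triGraph.Walk x₂ y₂) (hR : 1 ≤ R)
    (hvr : (r₀ : ℤ) + 2 * R ≤ triNorm v) (hvN : triNorm v + 2 * R ≤ N)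
    (hr' : 1 ≤ r') (hr'R : r' ≤ R) (hPr' : triNorm (P - v) < r')
    (hx₁ : triNorm x₁ = r₀) (hy₁ : triNorm y₁ = N) (hx₂ : triNorm x₂ = r₀) (hy₂ : triNorm y₂ = N)
    (ho₁path : o₁.IsPath) (ho₂path : o₂.IsPath)
    (ho₁ann : ∀ z ∈ o₁.support, (r₀ : ℤ) ≤ triNorm z ∧ triNorm z ≤ N)
    (hvo₁ : v ∈ o₁.support) (ho₁ω : ∀ z ∈ o₁.support, z ≠ v → z ∈ ω)
    (ho₂ω : ∀ z ∈ o₂.support, z ∈ ω ∧ z ≠ v) (hdisj : ∀ z ∈ o₁.support, z ∉ o₂.support)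
    (hPo₂ : P ∈ o₂.support)
    (hcut : ∀ (s t : Site 2) (q : triGraph.Walk s t), triNorm s = r₀ → triNorm t = N →
      (∀ z ∈ q.support, ((r₀ : ℤ) ≤ triNorm z ∧ triNorm z ≤ N) ∧ z ∈ ω ∧ z ≠ v) →
      P ∈ q.support) :
    SiteConfig.relabel (triShiftIso (-v)).toEquiv ω ∈
      armEvent ![true, true, true, true, false, false] r' R := by
  classical
  have hPo₁ : P ∉ o₁.support := fun h => hdisj P h hPo₂
  have h4 := relabel_shift_diff_mem_armEvent_of_cut o₁ hR hvr hvN hx₁ hy₁ ho₁ann ho₁ω hPo₁ hcut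
  -- translation bookkeeping
  set φ := triShiftIso (-v) with hφ
  have hφapp : ∀ w, φ w = w - v := fun w => by simp [hφ, sub_eq_add_neg]
  have hsymm : ∀ w, φ.toEquiv.symm w = w + v := by
    intro w
    apply φ.toEquiv.injective
    rw [Equiv.apply_symm_apply]
    show w = φ (w + v)
    rw [hφapp]; simp
  have himage : ∀ (T : Set (Site 2)) (w : Site 2), w ∈ φ '' T ↔ w + v ∈ T := by
    intro T w
    constructor
    · rintro ⟨w', hw', rfl⟩; rw [hφapp]; simpa using hw'
    · intro hw; exact ⟨w + v, hw, by rw [hφapp]; simp⟩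
  have hmemω : ∀ w, w ∈ SiteConfig.relabel φ.toEquiv ω ↔ w + v ∈ ω := fun w => by
    rw [SiteConfig.mem_relabel_iff, hsymm]
  have hmemξ : ∀ w, w ∈ SiteConfig.relabel φ.toEquiv (ω \ {P}) ↔ w + v ∈ ω \ {P} := fun w => by
    rw [SiteConfig.mem_relabel_iff, hsymm]
  have hφv : φ v = 0 := by rw [hφapp, sub_self]
  -- sizes
  have hx₁far : (R : ℤ) ≤ triNorm (φ x₁) := by
    rw [hφapp]
    have h1 := triNorm_add_le (v - x₁) x₁
    rw [sub_add_cancel] at h1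
    have h2 : triNorm (x₁ - v) = triNorm (v - x₁) := by rw [← triNorm_neg, neg_sub]
    omega
  have hy₁far : (R : ℤ) ≤ triNorm (φ y₁) := by
    rw [hφapp]
    have := triNorm_add_le (y₁ - v) v
    rw [sub_add_cancel] at this
    omega
  have hx₂far : (R : ℤ) ≤ triNorm (φ x₂) := by
    rw [hφapp]
    have h1 := triNorm_add_le (v - x₂) x₂
    rw [sub_add_cancel] at h1
    have h2 : triNorm (x₂ - v) = triNorm (v - x₂) := by rw [← triNorm_neg, neg_sub]
    omega
  have hy₂far : (R : ℤ) ≤ triNorm (φ y₂) := by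
    rw [hφapp]
    have := triNorm_add_le (y₂ - v) v
    rw [sub_add_cancel] at this
    omega
  have hφP : triNorm (φ P) ≤ r' := by rw [hφapp]; omega
  -- sites of the annulus `{r' ≤ |·| ≤ R}` are neither `0` nor `P - v`
  have hne0 : ∀ {z : Site 2}, (r' : ℤ) ≤ triNorm z → z ≠ 0 := by
    intro z hz h; rw [h, triNorm_zero] at hz; omega
  have hneP : ∀ {z : Site 2}, (r' : ℤ) ≤ triNorm z → z + v ≠ P := by
    intro z hz h
    have : z = P - v := by rw [← h, add_sub_cancel_right]
    rw [this] at hz; omega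
  -- the two closed arms of `ω ∖ {P}` at scale `R`
  obtain ⟨xa, ya, wa, hwa, hdja⟩ := h4
  have hcl : ∀ j : Fin 4, ![true, false, true, false] j = false →
      ∀ z ∈ (wa j).support, (r' : ℤ) ≤ triNorm z → z + v ∉ ω := by
    intro j hj z hz hzr hzω
    have h := (hwa j).2.2.2.2 z hz
    rw [hj, hmemξ] at h
    have hmem : z + v ∈ ω \ {P} := ⟨hzω, by rw [mem_singleton_iff]; exact hneP hzr⟩
    exact Bool.false_ne_true (h.1 hmem)
  have hwa_ann : ∀ j : Fin 4, ∀ z ∈ (wa j).support, (1 : ℤ) ≤ triNorm z ∧ triNorm z ≤ R :=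
    fun j z hz => by
      have := mem_triAnnulus.1 (mem_triAnnulus_of_arm hR ((hwa j).2.2.2.1 z hz))
      exact_mod_cast this
  -- splitting the open arms at `v` and at `P`
  obtain ⟨o₁a, o₁b, ho₁⟩ := SimpleGraph.Walk.mem_support_iff_exists_append.1 hvo₁
  obtain ⟨o₂a, o₂b, ho₂⟩ := SimpleGraph.Walk.mem_support_iff_exists_append.1 hPo₂
  have ho₁split : (o₁a.append o₁b).IsPath := by rw [← ho₁]; exact ho₁path
  have ho₂split : (o₂a.append o₂b).IsPath := by rw [← ho₂]; exact ho₂path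
  obtain ⟨-, -, ho₁ab⟩ := Literature.Combinatorics.SimpleGraph.isPath_append_iff'.1 ho₁split
  obtain ⟨-, -, ho₂ab⟩ := Literature.Combinatorics.SimpleGraph.isPath_append_iff'.1 ho₂split
  have ho₁a : ∀ z ∈ o₁a.support, z ∈ o₁.support := fun z hz => by
    rw [ho₁, SimpleGraph.Walk.mem_support_append_iff]; exact Or.inl hz
  have ho₁b : ∀ z ∈ o₁b.support, z ∈ o₁.support := fun z hz => by
    rw [ho₁, SimpleGraph.Walk.mem_support_append_iff]; exact Or.inr hz
  have ho₂a : ∀ z ∈ o₂a.support, z ∈ o₂.support := fun z hz => by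
    rw [ho₂, SimpleGraph.Walk.mem_support_append_iff]; exact Or.inl hz
  have ho₂b : ∀ z ∈ o₂b.support, z ∈ o₂.support := fun z hz => by
    rw [ho₂, SimpleGraph.Walk.mem_support_append_iff]; exact Or.inr hz
  -- the six site sets, inside the annulus `{r' ≤ |·| ≤ R}` (translated coordinates)
  obtain ⟨S0, hS0⟩ : ∃ S : Set (Site 2), ∀ z, z ∈ S ↔
      (z + v ∈ o₁a.support ∧ z ≠ 0) ∧ ((r' : ℤ) ≤ triNorm z ∧ triNorm z ≤ R) :=
    ⟨{z | _}, fun _ => Iff.rfl⟩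
  obtain ⟨S1, hS1⟩ : ∃ S : Set (Site 2), ∀ z, z ∈ S ↔
      (z + v ∈ o₁b.support ∧ z ≠ 0) ∧ ((r' : ℤ) ≤ triNorm z ∧ triNorm z ≤ R) :=
    ⟨{z | _}, fun _ => Iff.rfl⟩
  obtain ⟨S2, hS2⟩ : ∃ S : Set (Site 2), ∀ z, z ∈ S ↔
      (z + v ∈ o₂a.support ∧ z + v ≠ P) ∧ ((r' : ℤ) ≤ triNorm z ∧ triNorm z ≤ R) :=
    ⟨{z | _}, fun _ => Iff.rfl⟩
  obtain ⟨S3, hS3⟩ : ∃ S : Set (Site 2), ∀ z, z ∈ S ↔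
      (z + v ∈ o₂b.support ∧ z + v ≠ P) ∧ ((r' : ℤ) ≤ triNorm z ∧ triNorm z ≤ R) :=
    ⟨{z | _}, fun _ => Iff.rfl⟩
  obtain ⟨S4, hS4⟩ : ∃ S : Set (Site 2), ∀ z, z ∈ S ↔
      z ∈ (wa 1).support ∧ ((r' : ℤ) ≤ triNorm z ∧ triNorm z ≤ R) :=
    ⟨{z | _}, fun _ => Iff.rfl⟩
  obtain ⟨S5, hS5⟩ : ∃ S : Set (Site 2), ∀ z, z ∈ S ↔
      z ∈ (wa 3).support ∧ ((r' : ℤ) ≤ triNorm z ∧ triNorm z ≤ R) :=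
    ⟨{z | _}, fun _ => Iff.rfl⟩
  -- colours
  have hO0 : ∀ z ∈ S0, z + v ∈ ω := fun z hz => by
    obtain ⟨⟨h1, h2⟩, -⟩ := (hS0 z).1 hz
    exact ho₁ω _ (ho₁a _ h1) fun h => h2 (by simpa using congrArg (· - v) h)
  have hO1 : ∀ z ∈ S1, z + v ∈ ω := fun z hz => by
    obtain ⟨⟨h1, h2⟩, -⟩ := (hS1 z).1 hz
    exact ho₁ω _ (ho₁b _ h1) fun h => h2 (by simpa using congrArg (· - v) h)
  have hO2 : ∀ z ∈ S2, z + v ∈ ω := fun z hz => (ho₂ω _ (ho₂a _ ((hS2 z).1 hz).1.1)).1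
  have hO3 : ∀ z ∈ S3, z + v ∈ ω := fun z hz => (ho₂ω _ (ho₂b _ ((hS3 z).1 hz).1.1)).1
  have hC4 : ∀ z ∈ S4, z + v ∉ ω := fun z hz =>
    hcl 1 rfl z ((hS4 z).1 hz).1 ((hS4 z).1 hz).2.1
  have hC5 : ∀ z ∈ S5, z + v ∉ ω := fun z hz =>
    hcl 3 rfl z ((hS5 z).1 hz).1 ((hS5 z).1 hz).2.1
  -- pairwise disjointness of the six sets
  have hoc : ∀ {S T : Set (Site 2)}, (∀ z ∈ S, z + v ∈ ω) → (∀ z ∈ T, z + v ∉ ω) →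
      Disjoint S T := fun hS hT => Set.disjoint_left.2 fun z hz hz' => hT z hz' (hS z hz)
  have d01 : Disjoint S0 S1 := Set.disjoint_left.2 fun z hz hz' => by
    obtain ⟨⟨h1, h2⟩, -⟩ := (hS0 z).1 hz
    obtain ⟨⟨h1', -⟩, -⟩ := (hS1 z).1 hz'
    have : z + v = v := ho₁ab _ h1 h1'
    exact h2 (by simpa using congrArg (· - v) this)
  have d02 : Disjoint S0 S2 := Set.disjoint_left.2 fun z hz hz' =>
    hdisj _ (ho₁a _ ((hS0 z).1 hz).1.1) (ho₂a _ ((hS2 z).1 hz').1.1)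
  have d03 : Disjoint S0 S3 := Set.disjoint_left.2 fun z hz hz' =>
    hdisj _ (ho₁a _ ((hS0 z).1 hz).1.1) (ho₂b _ ((hS3 z).1 hz').1.1)
  have d12 : Disjoint S1 S2 := Set.disjoint_left.2 fun z hz hz' =>
    hdisj _ (ho₁b _ ((hS1 z).1 hz).1.1) (ho₂a _ ((hS2 z).1 hz').1.1)
  have d13 : Disjoint S1 S3 := Set.disjoint_left.2 fun z hz hz' =>
    hdisj _ (ho₁b _ ((hS1 z).1 hz).1.1) (ho₂b _ ((hS3 z).1 hz').1.1)
  have d23 : Disjoint S2 S3 := Set.disjoint_left.2 fun z hz hz' => by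
    obtain ⟨⟨h1, h2⟩, -⟩ := (hS2 z).1 hz
    obtain ⟨⟨h1', -⟩, -⟩ := (hS3 z).1 hz'
    exact h2 (ho₂ab _ h1 h1')
  have d45 : Disjoint S4 S5 := Set.disjoint_left.2 fun z hz hz' =>
    Finset.disjoint_left.1 (hdja (show (1 : Fin 4) ≠ 3 by decide))
      (List.mem_toFinset.2 ((hS4 z).1 hz).1) (List.mem_toFinset.2 ((hS5 z).1 hz').1)
  -- the six paths across the annulus
  have hp0 : ∃ a ∈ triSphere r', ∃ b ∈ triSphere R, PathIn triGraph S0 a b := by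
    have h : PathIn triGraph {z : Site 2 | z + v ∈ o₁a.support} (φ v) (φ x₁) := by
      have h := pathIn_map_iso φ (PathIn.of_walk (A := {z : Site 2 | z ∈ o₁a.support})
        o₁a.reverse fun z hz => by
          rw [SimpleGraph.Walk.support_reverse, List.mem_reverse] at hz; exact hz)
      exact h.mono fun z hz => (himage _ z).1 hz
    obtain ⟨a, b, ha, hb, hp⟩ := h.exists_arm_of_triNorm_le (r := r') (R := R)
      (by rw [hφv, triNorm_zero]; positivity) hx₁far hr'R
    refine ⟨a, mem_triSphere_iff.2 ha, b, mem_triSphere_iff.2 hb, hp.mono ?_⟩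
    rintro z ⟨hz1, hz2⟩
    exact (hS0 z).2 ⟨⟨hz2, hne0 hz1.1⟩, hz1⟩
  have hp1 : ∃ a ∈ triSphere r', ∃ b ∈ triSphere R, PathIn triGraph S1 a b := by
    have h : PathIn triGraph {z : Site 2 | z + v ∈ o₁b.support} (φ v) (φ y₁) := by
      have h := pathIn_map_iso φ (PathIn.of_walk (A := {z : Site 2 | z ∈ o₁b.support})
        o₁b fun z hz => hz)
      exact h.mono fun z hz => (himage _ z).1 hz
    obtain ⟨a, b, ha, hb, hp⟩ := h.exists_arm_of_triNorm_le (r := r') (R := R)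
      (by rw [hφv, triNorm_zero]; positivity) hy₁far hr'R
    refine ⟨a, mem_triSphere_iff.2 ha, b, mem_triSphere_iff.2 hb, hp.mono ?_⟩
    rintro z ⟨hz1, hz2⟩
    exact (hS1 z).2 ⟨⟨hz2, hne0 hz1.1⟩, hz1⟩
  have hp2 : ∃ a ∈ triSphere r', ∃ b ∈ triSphere R, PathIn triGraph S2 a b := by
    have h : PathIn triGraph {z : Site 2 | z + v ∈ o₂a.support} (φ P) (φ x₂) := by
      have h := pathIn_map_iso φ (PathIn.of_walk (A := {z : Site 2 | z ∈ o₂a.support})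
        o₂a.reverse fun z hz => by
          rw [SimpleGraph.Walk.support_reverse, List.mem_reverse] at hz; exact hz)
      exact h.mono fun z hz => (himage _ z).1 hz
    obtain ⟨a, b, ha, hb, hp⟩ := h.exists_arm_of_triNorm_le (r := r') (R := R) hφP hx₂far hr'R
    refine ⟨a, mem_triSphere_iff.2 ha, b, mem_triSphere_iff.2 hb, hp.mono ?_⟩
    rintro z ⟨hz1, hz2⟩
    exact (hS2 z).2 ⟨⟨hz2, hneP hz1.1⟩, hz1⟩
  have hp3 : ∃ a ∈ triSphere r', ∃ b ∈ triSphere R, PathIn triGraph S3 a b := by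
    have h : PathIn triGraph {z : Site 2 | z + v ∈ o₂b.support} (φ P) (φ y₂) := by
      have h := pathIn_map_iso φ (PathIn.of_walk (A := {z : Site 2 | z ∈ o₂b.support})
        o₂b fun z hz => hz)
      exact h.mono fun z hz => (himage _ z).1 hz
    obtain ⟨a, b, ha, hb, hp⟩ := h.exists_arm_of_triNorm_le (r := r') (R := R) hφP hy₂far hr'R
    refine ⟨a, mem_triSphere_iff.2 ha, b, mem_triSphere_iff.2 hb, hp.mono ?_⟩
    rintro z ⟨hz1, hz2⟩
    exact (hS3 z).2 ⟨⟨hz2, hneP hz1.1⟩, hz1⟩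
  have hp45 : ∀ j : Fin 4, ∃ a ∈ triSphere r', ∃ b ∈ triSphere R,
      PathIn triGraph ({w : Site 2 | (r' : ℤ) ≤ triNorm w ∧ triNorm w ≤ R} ∩
        {z | z ∈ (wa j).support}) a b := by
    intro j
    obtain ⟨hxa, hya, -, -, -⟩ := hwa j
    have h : PathIn triGraph {z : Site 2 | z ∈ (wa j).support} (xa j) (ya j) :=
      PathIn.of_walk (wa j) fun z hz => hz
    obtain ⟨a, b, ha, hb, hp⟩ := h.exists_arm_of_triNorm_le (r := r') (R := R)
      (by rw [mem_triSphere_iff.1 hxa]; exact_mod_cast hr')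
      (by rw [mem_triSphere_iff.1 hya]) hr'R
    exact ⟨a, mem_triSphere_iff.2 ha, b, mem_triSphere_iff.2 hb, hp⟩
  have hp4 : ∃ a ∈ triSphere r', ∃ b ∈ triSphere R, PathIn triGraph S4 a b := by
    obtain ⟨a, ha, b, hb, hp⟩ := hp45 1
    exact ⟨a, ha, b, hb, hp.mono fun z hz => (hS4 z).2 ⟨hz.2, hz.1⟩⟩
  have hp5 : ∃ a ∈ triSphere r', ∃ b ∈ triSphere R, PathIn triGraph S5 a b := by
    obtain ⟨a, ha, b, hb, hp⟩ := hp45 3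
    exact ⟨a, ha, b, hb, hp.mono fun z hz => (hS5 z).2 ⟨hz.2, hz.1⟩⟩
  -- assemble
  obtain ⟨U, hU0, hU1, hU2, hU3, hU4, hU5⟩ : ∃ U : Fin 6 → Set (Site 2),
      U 0 = S0 ∧ U 1 = S1 ∧ U 2 = S2 ∧ U 3 = S3 ∧ U 4 = S4 ∧ U 5 = S5 :=
    ⟨![S0, S1, S2, S3, S4, S5], rfl, rfl, rfl, rfl, rfl, rfl⟩
  refine mem_armEvent_of_pathIn ![true, true, true, true, false, false] U ?_ ?_ ?_ ?_
  · intro a b hab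
    fin_cases a <;> fin_cases b
    · exact absurd rfl hab
    · change Disjoint (U 0) (U 1); rw [hU0, hU1]; exact d01
    · change Disjoint (U 0) (U 2); rw [hU0, hU2]; exact d02
    · change Disjoint (U 0) (U 3); rw [hU0, hU3]; exact d03
    · change Disjoint (U 0) (U 4); rw [hU0, hU4]; exact hoc hO0 hC4
    · change Disjoint (U 0) (U 5); rw [hU0, hU5]; exact hoc hO0 hC5
    · change Disjoint (U 1) (U 0); rw [hU1, hU0]; exact d01.symm
    · exact absurd rfl hab
    · change Disjoint (U 1) (U 2); rw [hU1, hU2]; exact d12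
    · change Disjoint (U 1) (U 3); rw [hU1, hU3]; exact d13
    · change Disjoint (U 1) (U 4); rw [hU1, hU4]; exact hoc hO1 hC4
    · change Disjoint (U 1) (U 5); rw [hU1, hU5]; exact hoc hO1 hC5
    · change Disjoint (U 2) (U 0); rw [hU2, hU0]; exact d02.symm
    · change Disjoint (U 2) (U 1); rw [hU2, hU1]; exact d12.symm
    · exact absurd rfl hab
    · change Disjoint (U 2) (U 3); rw [hU2, hU3]; exact d23
    · change Disjoint (U 2) (U 4); rw [hU2, hU4]; exact hoc hO2 hC4
    · change Disjoint (U 2) (U 5); rw [hU2, hU5]; exact hoc hO2 hC5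
    · change Disjoint (U 3) (U 0); rw [hU3, hU0]; exact d03.symm
    · change Disjoint (U 3) (U 1); rw [hU3, hU1]; exact d13.symm
    · change Disjoint (U 3) (U 2); rw [hU3, hU2]; exact d23.symm
    · exact absurd rfl hab
    · change Disjoint (U 3) (U 4); rw [hU3, hU4]; exact hoc hO3 hC4
    · change Disjoint (U 3) (U 5); rw [hU3, hU5]; exact hoc hO3 hC5
    · change Disjoint (U 4) (U 0); rw [hU4, hU0]; exact (hoc hO0 hC4).symm
    · change Disjoint (U 4) (U 1); rw [hU4, hU1]; exact (hoc hO1 hC4).symm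
    · change Disjoint (U 4) (U 2); rw [hU4, hU2]; exact (hoc hO2 hC4).symm
    · change Disjoint (U 4) (U 3); rw [hU4, hU3]; exact (hoc hO3 hC4).symm
    · exact absurd rfl hab
    · change Disjoint (U 4) (U 5); rw [hU4, hU5]; exact d45
    · change Disjoint (U 5) (U 0); rw [hU5, hU0]; exact (hoc hO0 hC5).symm
    · change Disjoint (U 5) (U 1); rw [hU5, hU1]; exact (hoc hO1 hC5).symm
    · change Disjoint (U 5) (U 2); rw [hU5, hU2]; exact (hoc hO2 hC5).symm
    · change Disjoint (U 5) (U 3); rw [hU5, hU3]; exact (hoc hO3 hC5).symm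
    · change Disjoint (U 5) (U 4); rw [hU5, hU4]; exact d45.symm
    · exact absurd rfl hab
  · intro a z hz
    fin_cases a
    · change z ∈ U 0 at hz; rw [hU0] at hz
      change (z ∈ SiteConfig.relabel φ.toEquiv ω ↔ true = true)
      rw [hmemω]; exact ⟨fun _ => rfl, fun _ => hO0 z hz⟩
    · change z ∈ U 1 at hz; rw [hU1] at hz
      change (z ∈ SiteConfig.relabel φ.toEquiv ω ↔ true = true)
      rw [hmemω]; exact ⟨fun _ => rfl, fun _ => hO1 z hz⟩
    · change z ∈ U 2 at hz; rw [hU2] at hz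
      change (z ∈ SiteConfig.relabel φ.toEquiv ω ↔ true = true)
      rw [hmemω]; exact ⟨fun _ => rfl, fun _ => hO2 z hz⟩
    · change z ∈ U 3 at hz; rw [hU3] at hz
      change (z ∈ SiteConfig.relabel φ.toEquiv ω ↔ true = true)
      rw [hmemω]; exact ⟨fun _ => rfl, fun _ => hO3 z hz⟩
    · change z ∈ U 4 at hz; rw [hU4] at hz
      change (z ∈ SiteConfig.relabel φ.toEquiv ω ↔ false = true)
      rw [hmemω]; exact ⟨fun h => absurd h (hC4 z hz), fun h => absurd h Bool.false_ne_true⟩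
    · change z ∈ U 5 at hz; rw [hU5] at hz
      change (z ∈ SiteConfig.relabel φ.toEquiv ω ↔ false = true)
      rw [hmemω]; exact ⟨fun h => absurd h (hC5 z hz), fun h => absurd h Bool.false_ne_true⟩
  · intro a z hz
    fin_cases a
    · change z ∈ U 0 at hz; rw [hU0] at hz; exact ((hS0 z).1 hz).2
    · change z ∈ U 1 at hz; rw [hU1] at hz; exact ((hS1 z).1 hz).2
    · change z ∈ U 2 at hz; rw [hU2] at hz; exact ((hS2 z).1 hz).2
    · change z ∈ U 3 at hz; rw [hU3] at hz; exact ((hS3 z).1 hz).2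
    · change z ∈ U 4 at hz; rw [hU4] at hz; exact ((hS4 z).1 hz).2
    · change z ∈ U 5 at hz; rw [hU5] at hz; exact ((hS5 z).1 hz).2
  · intro a
    fin_cases a
    · change ∃ a ∈ triSphere r', ∃ b ∈ triSphere R, PathIn triGraph (U 0) a b; rw [hU0]; exact hp0
    · change ∃ a ∈ triSphere r', ∃ b ∈ triSphere R, PathIn triGraph (U 1) a b; rw [hU1]; exact hp1
    · change ∃ a ∈ triSphere r', ∃ b ∈ triSphere R, PathIn triGraph (U 2) a b; rw [hU2]; exact hp2
    · change ∃ a ∈ triSphere r', ∃ b ∈ triSphere R, PathIn triGraph (U 3) a b; rw [hU3]; exact hp3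
    · change ∃ a ∈ triSphere r', ∃ b ∈ triSphere R, PathIn triGraph (U 4) a b; rw [hU4]; exact hp4
    · change ∃ a ∈ triSphere r', ∃ b ∈ triSphere R, PathIn triGraph (U 5) a b; rw [hU5]; exact hp5

end Cut

end Literature.Probability.Percolation
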